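import Summits.QuantumFields.YangMills.Theorems.FluctuationComparisonRegPrIntLOrganTangentFibreMeanSquareTransport
import Summits.QuantumFields.YangMills.Theorems.FluctuationComparisonRegPrIntLOrganTangentFibreMeanSquareResponse
import HarnessLib

/-!
# Crux `FluctuationComparisonRegPrIntL` (stmt-QuantumFields-20520, rung R3), PATH-B organ, v18 (H-currency) — (L21d) THE KNIT'S DOCK, ASSEMBLED:
# the four CORNER REPRESENTATIONS on the reference fibre law `σ U₀` (exported as a package) and ✓R2b's RESPONSE READING `|ΔΔ𝔪| ≤ A + L₁ + L₂ + L₀` there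

Cell `ym3-torus` (YM ladder rung R3 = continuum `SU(2)` Yang–Mills on the three-torus — a RUNG: NOT d = 4, NOT infinite volume, NOT a mass gap, NOT Clay).
Width seat `ym-ust-20520-w5` (gen 23), `--supports stmt-QuantumFields-20520 --as helper`, count-neutral, no registry ∕ binder ∕ `Lines/` edit, DEFINITION-FREE,
default heartbeats.  Over (L21b) ✓p809169, (L21c) ✓p810171, (R2b) ✓p810608 (LEAD w3 g25 №23: «the LIN knit will be LITERALLY `abs_fibreMean_secondDiff_le_response`
at the a.e. reference corner of ✓L21c»).

WHAT THIS IS.  Data as in (L21c): `m` finite on standard-Borel `Y`, `d : Y → X`, Markov disintegration `σ` (`bind` + fibre clause), two coarse moves `g₁ g₂ : X ≃ᵐ X`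
with covering fine transports `τ₁ τ₂` and change-of-variables letters `r₁ r₂ > 0`, bounded measurable `h` and weight `b` (`|h| ≤ M`, `|b| ≤ Mb`, `0 ≤ b`); the
σ-fibre mean `𝔪(V) := (∫ h·b ∂σ V) ∕ (∫ b ∂σ V)`; the NORMALISED WEIGHTS on the reference fibre `σ U₀`:
`ŵ₀₀ = b∕D₀₀`, `ŵ₁₀ = r₁·(b∘τ₁)∕D₁₀`, `ŵ₀₁ = r₂·(b∘τ₂)∕D₀₁`, `ŵ₁₁ = r₁·(r₂∘τ₁)·(b∘τ₂∘τ₁)∕D₁₁` (`D_ab` the corresponding `σ U₀`-integrals).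
* §1 ★★`ae_corner_package_transport` — for `(m.map d)`-a.e. `U₀` with the four corner masses `∫ b ∂σ(·) ≠ 0`: the four REPRESENTATIONS `𝔪(U₀) = ∫ h·ŵ₀₀`,
  `𝔪(g₁U₀) = ∫ (h∘τ₁)·ŵ₁₀`, `𝔪(g₂U₀) = ∫ (h∘τ₂)·ŵ₀₁`, `𝔪(g₂(g₁U₀)) = ∫ (h∘τ₂∘τ₁)·ŵ₁₁` (all `∂σ U₀`), the four NORMALISATIONS `∫ ŵ_ab = 1`, the four
  INTEGRABILITIES and the NON-NEGATIVITY of the weights — exported so that ANY reading of ✓2b (✓R2b response, ✓B3 covariance, ✓TS good∕bad, zoned) applies at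
  the reference corner without redoing the transport bookkeeping.
* §2 ★★★`ae_abs_fibreMean_secondDiff_le_response_transport` — ✓R2b's `abs_fibreMean_secondDiff_le_response` AT THE REFERENCE CORNER: for a.e. `U₀` (corner masses
  `≠ 0`) and ANY numbers `A L₁ L₂ L₀` bounding the pull-back bracket `|∫ ΔΔF·ŵ₁₁|`, the two first-order response brackets `|(∫G₁ŵ₁₁) − (∫G₁ŵ₁₀)|`,
  `|(∫G₂ŵ₁₁) − (∫G₂ŵ₀₁)|` (`G₁ = h∘τ₁ − h`, `G₂ = h∘τ₂ − h`) and the second-order response bracket on `F₀₀ = h`:  `|ΔΔ𝔪| ≤ A + L₁ + L₂ + L₀`.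
  (`A` ⟸ JOINT-TRANSPORT-H + ✓TS ∕ ✓`abs_pullback_le_of_sup` ∕ ✓(IPL); `L₁ L₂` ⟸ (L1ʲ); `L₀` ⟸ (L2ʲ) — HYPOTHESES of FibreLawH v0.2, LEAD №23 (D1)–(D3).)

HONEST FRAMING: measure-theoretic plumbing over HYPOTHESIS letters; no transport ∕ letter ∕ weight constructed, no letter estimated; nothing of Bałaban's analysis is
asserted or proved; JOINT-TRANSPORT-H ∕ FibreLawH ∕ LINᵘ-H ∕ O1ᵘ-H v2∕v2.1 ∕ S1aᴴ ∕ 26243 ∕ S2α′ ∕ S2β OPEN; crux 20520 `FluctuationComparisonRegPrIntL` ∕ `YM3TorusSU2` NOT proved;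
no summit ∕ sub-problem statement is proved; registry untouched; rung R3 = SU(2) YM₃ on T³ at fixed lattice data — NOT d = 4, NOT infinite volume, NOT a mass gap, NOT
Clay; the Yang–Mills mass gap is NOT proved.  [folklore] measure theory.
-/

set_option autoImplicit false

noncomputable section

namespace Summit.QuantumFields.YangMills.Theorems.OrganTangentFibreMeanSquareTransportResponse

open MeasureTheory ProbabilityTheory Filter Topology Set
open scoped ENNReal
open Summit.QuantumFields.YangMills.Theorems.OrganTangentDisintegrationTransport
open Summit.QuantumFields.YangMills.Theorems.OrganTangentFibreMeanTransport
open Summit.QuantumFields.YangMills.Theorems.OrganTangentFibreMeanSquareTransport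
open Summit.QuantumFields.YangMills.Theorems.OrganTangentFibreMeanSquareResponse

variable {X Y : Type*} [MeasurableSpace X] [MeasurableSpace Y]

/-- ★★ **THE CORNER PACKAGE ON THE REFERENCE FIBRE LAW** (see the module docstring). [folklore] -/
theorem ae_corner_package_transport [StandardBorelSpace Y] [Nonempty Y] [MeasurableSingletonClass X]
    (m : Measure Y) [IsFiniteMeasure m] {d : Y → X} (hd : Measurable d)
    (σ : Kernel X Y) [IsMarkovKernel σ]
    (hbind : (m.map d).bind ⇑σ = m) (hfib : ∀ᵐ V ∂(m.map d), ∀ᵐ U ∂(σ V), d U = V)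
    (g₁ g₂ : X ≃ᵐ X) {τ₁ τ₂ : Y → Y} (hτ₁ : Measurable τ₁) (hτ₂ : Measurable τ₂)
    (hcov₁ : ∀ U, d (τ₁ U) = g₁ (d U)) (hcov₂ : ∀ U, d (τ₂ U) = g₂ (d U))
    {r₁ r₂ : Y → ℝ} (hr₁ : Measurable r₁) (hr₂ : Measurable r₂) (hr₁pos : ∀ U, 0 < r₁ U) (hr₂pos : ∀ U, 0 < r₂ U)
    (hcv₁ : (m.withDensity (fun U => ENNReal.ofReal (r₁ U))).map τ₁ = m)
    (hcv₂ : (m.withDensity (fun U => ENNReal.ofReal (r₂ U))).map τ₂ = m)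
    {h b : Y → ℝ} (hh : Measurable h) (hb : Measurable b) {Mb : ℝ} (hbM : ∀ U, |b U| ≤ Mb) (hb0 : ∀ U, 0 ≤ b U) :
    ∀ᵐ U₀ ∂(m.map d),
      (∫ U, b U ∂(σ U₀)) ≠ 0 → (∫ U, b U ∂(σ (g₁ U₀))) ≠ 0 → (∫ U, b U ∂(σ (g₂ U₀))) ≠ 0 → (∫ U, b U ∂(σ (g₂ (g₁ U₀)))) ≠ 0 →
      ((∫ U, h U * b U ∂(σ U₀)) / (∫ U, b U ∂(σ U₀)) = ∫ U, h U * (b U / ∫ U', b U' ∂(σ U₀)) ∂(σ U₀)) ∧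
      ((∫ U, h U * b U ∂(σ (g₁ U₀))) / (∫ U, b U ∂(σ (g₁ U₀)))
          = ∫ U, h (τ₁ U) * (r₁ U * b (τ₁ U) / ∫ U', r₁ U' * b (τ₁ U') ∂(σ U₀)) ∂(σ U₀)) ∧
      ((∫ U, h U * b U ∂(σ (g₂ U₀))) / (∫ U, b U ∂(σ (g₂ U₀)))
          = ∫ U, h (τ₂ U) * (r₂ U * b (τ₂ U) / ∫ U', r₂ U' * b (τ₂ U') ∂(σ U₀)) ∂(σ U₀)) ∧
      ((∫ U, h U * b U ∂(σ (g₂ (g₁ U₀)))) / (∫ U, b U ∂(σ (g₂ (g₁ U₀))))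
          = ∫ U, h (τ₂ (τ₁ U)) * (r₁ U * r₂ (τ₁ U) * b (τ₂ (τ₁ U)) / ∫ U', r₁ U' * r₂ (τ₁ U') * b (τ₂ (τ₁ U')) ∂(σ U₀)) ∂(σ U₀)) ∧
      (∫ U, b U / (∫ U', b U' ∂(σ U₀)) ∂(σ U₀) = 1) ∧
      (∫ U, r₁ U * b (τ₁ U) / (∫ U', r₁ U' * b (τ₁ U') ∂(σ U₀)) ∂(σ U₀) = 1) ∧
      (∫ U, r₂ U * b (τ₂ U) / (∫ U', r₂ U' * b (τ₂ U') ∂(σ U₀)) ∂(σ U₀) = 1) ∧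
      (∫ U, r₁ U * r₂ (τ₁ U) * b (τ₂ (τ₁ U)) / (∫ U', r₁ U' * r₂ (τ₁ U') * b (τ₂ (τ₁ U')) ∂(σ U₀)) ∂(σ U₀) = 1) ∧
      Integrable (fun U => b U / ∫ U', b U' ∂(σ U₀)) (σ U₀) ∧
      Integrable (fun U => r₁ U * b (τ₁ U) / ∫ U', r₁ U' * b (τ₁ U') ∂(σ U₀)) (σ U₀) ∧
      Integrable (fun U => r₂ U * b (τ₂ U) / ∫ U', r₂ U' * b (τ₂ U') ∂(σ U₀)) (σ U₀) ∧
      Integrable (fun U => r₁ U * r₂ (τ₁ U) * b (τ₂ (τ₁ U)) / ∫ U', r₁ U' * r₂ (τ₁ U') * b (τ₂ (τ₁ U')) ∂(σ U₀)) (σ U₀) ∧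
      (∀ U, 0 ≤ b U / ∫ U', b U' ∂(σ U₀)) ∧
      (∀ U, 0 ≤ r₁ U * b (τ₁ U) / ∫ U', r₁ U' * b (τ₁ U') ∂(σ U₀)) ∧
      (∀ U, 0 ≤ r₂ U * b (τ₂ U) / ∫ U', r₂ U' * b (τ₂ U') ∂(σ U₀)) ∧
      (∀ U, 0 ≤ r₁ U * r₂ (τ₁ U) * b (τ₂ (τ₁ U)) / ∫ U', r₁ U' * r₂ (τ₁ U') * b (τ₂ (τ₁ U')) ∂(σ U₀)) := by
  have hr₁0 : ∀ U, 0 ≤ r₁ U := fun U => (hr₁pos U).le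
  have hr₁₂ : Measurable fun U => r₁ U * r₂ (τ₁ U) := hr₁.mul (hr₂.comp hτ₁)
  have hr₁₂pos : ∀ U, 0 < r₁ U * r₂ (τ₁ U) := fun U => mul_pos (hr₁pos U) (hr₂pos _)
  have hcov₁₂ := cov_comp g₁ g₂ hcov₁ hcov₂
  have hcv₁₂ := cv_comp_real m hτ₁ hτ₂ hr₁ hr₂ hr₁0 hcv₁ hcv₂
  have T₁ := ae_fibreMean_transport m hd σ hbind hfib g₁ hτ₁ hcov₁ hr₁ hr₁pos hcv₁
  have T₂ := ae_fibreMean_transport m hd σ hbind hfib g₂ hτ₂ hcov₂ hr₂ hr₂pos hcv₂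
  have T₁₂ := ae_fibreMean_transport m hd σ hbind hfib (g₁.trans g₂) (hτ₂.comp hτ₁) hcov₁₂ hr₁₂ hr₁₂pos hcv₁₂
  have I₁ := ae_integral_transport m hd σ hbind hfib g₁ hτ₁ hcov₁ hr₁ hr₁pos hcv₁
  have I₂ := ae_integral_transport m hd σ hbind hfib g₂ hτ₂ hcov₂ hr₂ hr₂pos hcv₂
  have I₁₂ := ae_integral_transport m hd σ hbind hfib (g₁.trans g₂) (hτ₂.comp hτ₁) hcov₁₂ hr₁₂ hr₁₂pos hcv₁₂
  filter_upwards [T₁, T₂, T₁₂, I₁, I₂, I₁₂] with U₀ hT₁ hT₂ hT₁₂ hI₁ hI₂ hI₁₂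
  intro hD₀₀ hD₁₀ hD₀₁ hD₁₁
  have hE₁₀ : (∫ U, r₁ U * b (τ₁ U) ∂(σ U₀)) ≠ 0 := by
    intro h0; apply hD₁₀; rw [hI₁.2 b hb, h0, zero_div]
  have hE₀₁ : (∫ U, r₂ U * b (τ₂ U) ∂(σ U₀)) ≠ 0 := by
    intro h0; apply hD₀₁; rw [hI₂.2 b hb, h0, zero_div]
  have hE₁₁ : (∫ U, r₁ U * r₂ (τ₁ U) * b (τ₂ (τ₁ U)) ∂(σ U₀)) ≠ 0 := by
    intro h0
    apply hD₁₁
    have h := hI₁₂.2 b hb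
    rw [MeasurableEquiv.trans_apply] at h
    rw [h]
    simp only [Function.comp_apply]
    rw [h0, zero_div]
  obtain ⟨e₁₀, n₁₀⟩ := hT₁ h b hh hb hE₁₀
  obtain ⟨e₀₁, n₀₁⟩ := hT₂ h b hh hb hE₀₁
  have hT := hT₁₂ h b hh hb (by simpa only [Function.comp_apply] using hE₁₁)
  simp only [MeasurableEquiv.trans_apply, Function.comp_apply] at hT
  obtain ⟨e₁₁, n₁₁⟩ := hT
  obtain ⟨e₀₀, n₀₀⟩ := fibreMean_eq_integral_normalised (σ U₀) h b hD₀₀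
  -- integrability
  have ir₁ : Integrable r₁ (σ U₀) := by
    refine integrable_of_lintegral_lt_top _ hr₁ hr₁0 ?_
    have := hI₁.1
    rw [integral_eq_toReal_lintegral _ hr₁ hr₁0] at this
    exact lt_top_iff_ne_top.mpr (fun htop => by rw [htop, ENNReal.toReal_top] at this; exact lt_irrefl _ this)
  have ir₂ : Integrable r₂ (σ U₀) := by
    refine integrable_of_lintegral_lt_top _ hr₂ (fun U => (hr₂pos U).le) ?_
    have := hI₂.1
    rw [integral_eq_toReal_lintegral _ hr₂ (fun U => (hr₂pos U).le)] at this
    exact lt_top_iff_ne_top.mpr (fun htop => by rw [htop, ENNReal.toReal_top] at this; exact lt_irrefl _ this)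
  have ir₁₂ : Integrable (fun U => r₁ U * r₂ (τ₁ U)) (σ U₀) := by
    refine integrable_of_lintegral_lt_top _ hr₁₂ (fun U => (hr₁₂pos U).le) ?_
    have := hI₁₂.1
    rw [integral_eq_toReal_lintegral _ hr₁₂ (fun U => (hr₁₂pos U).le)] at this
    exact lt_top_iff_ne_top.mpr (fun htop => by rw [htop, ENNReal.toReal_top] at this; exact lt_irrefl _ this)
  have ib : Integrable b (σ U₀) := by
    refine (integrable_const Mb).mono' hb.aestronglyMeasurable (Eventually.of_forall fun U => ?_)
    rw [Real.norm_eq_abs]; exact hbM U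
  have iw₀₀ : Integrable (fun U => b U / ∫ U', b U' ∂(σ U₀)) (σ U₀) := ib.div_const _
  have iw₁₀ : Integrable (fun U => r₁ U * b (τ₁ U) / ∫ U', r₁ U' * b (τ₁ U') ∂(σ U₀)) (σ U₀) :=
    (integrable_mul_bdd _ ir₁ (hb.comp hτ₁) (fun U => hbM _)).div_const _
  have iw₀₁ : Integrable (fun U => r₂ U * b (τ₂ U) / ∫ U', r₂ U' * b (τ₂ U') ∂(σ U₀)) (σ U₀) :=
    (integrable_mul_bdd _ ir₂ (hb.comp hτ₂) (fun U => hbM _)).div_const _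
  have iw₁₁ : Integrable (fun U => r₁ U * r₂ (τ₁ U) * b (τ₂ (τ₁ U)) / ∫ U', r₁ U' * r₂ (τ₁ U') * b (τ₂ (τ₁ U')) ∂(σ U₀)) (σ U₀) :=
    (integrable_mul_bdd _ ir₁₂ (hb.comp (hτ₂.comp hτ₁)) (fun U => hbM _)).div_const _
  -- non-negativity (denominators are positive: non-negative integrands with non-zero integral)
  have hpos : ∀ {f : Y → ℝ}, (∀ U, 0 ≤ f U) → (∫ U, f U ∂(σ U₀)) ≠ 0 → ∀ U, 0 ≤ f U / ∫ U', f U' ∂(σ U₀) :=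
    fun hf hne U => div_nonneg (hf U) (integral_nonneg hf)
  refine ⟨e₀₀, e₁₀, e₀₁, e₁₁, n₀₀, n₁₀, n₀₁, n₁₁, iw₀₀, iw₁₀, iw₀₁, iw₁₁,
    hpos hb0 hD₀₀, hpos (fun U => mul_nonneg (hr₁0 U) (hb0 _)) hE₁₀,
    hpos (fun U => mul_nonneg (hr₂pos U).le (hb0 _)) hE₀₁, hpos (fun U => mul_nonneg (hr₁₂pos U).le (hb0 _)) hE₁₁⟩

/-- ★★★ **THE RESPONSE READING AT THE REFERENCE CORNER** (LEAD №23's knit statement shape): `|ΔΔ𝔪| ≤ A + L₁ + L₂ + L₀` for a.e. `U₀`, from bounds on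
the pull-back bracket and the three law-response brackets over `σ U₀` (see the module docstring). [folklore] -/
theorem ae_abs_fibreMean_secondDiff_le_response_transport [StandardBorelSpace Y] [Nonempty Y] [MeasurableSingletonClass X]
    (m : Measure Y) [IsFiniteMeasure m] {d : Y → X} (hd : Measurable d)
    (σ : Kernel X Y) [IsMarkovKernel σ]
    (hbind : (m.map d).bind ⇑σ = m) (hfib : ∀ᵐ V ∂(m.map d), ∀ᵐ U ∂(σ V), d U = V)
    (g₁ g₂ : X ≃ᵐ X) {τ₁ τ₂ : Y → Y} (hτ₁ : Measurable τ₁) (hτ₂ : Measurable τ₂)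
    (hcov₁ : ∀ U, d (τ₁ U) = g₁ (d U)) (hcov₂ : ∀ U, d (τ₂ U) = g₂ (d U))
    {r₁ r₂ : Y → ℝ} (hr₁ : Measurable r₁) (hr₂ : Measurable r₂) (hr₁pos : ∀ U, 0 < r₁ U) (hr₂pos : ∀ U, 0 < r₂ U)
    (hcv₁ : (m.withDensity (fun U => ENNReal.ofReal (r₁ U))).map τ₁ = m)
    (hcv₂ : (m.withDensity (fun U => ENNReal.ofReal (r₂ U))).map τ₂ = m)
    {h b : Y → ℝ} (hh : Measurable h) (hb : Measurable b) {M Mb : ℝ} (hhM : ∀ U, |h U| ≤ M) (hbM : ∀ U, |b U| ≤ Mb) (hb0 : ∀ U, 0 ≤ b U) :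
    ∀ᵐ U₀ ∂(m.map d),
      (∫ U, b U ∂(σ U₀)) ≠ 0 → (∫ U, b U ∂(σ (g₁ U₀))) ≠ 0 → (∫ U, b U ∂(σ (g₂ U₀))) ≠ 0 → (∫ U, b U ∂(σ (g₂ (g₁ U₀)))) ≠ 0 →
      ∀ (A L₁ L₂ L₀ : ℝ),
        |∫ U, (h (τ₂ (τ₁ U)) - h (τ₁ U) - h (τ₂ U) + h U)
            * (r₁ U * r₂ (τ₁ U) * b (τ₂ (τ₁ U)) / ∫ U', r₁ U' * r₂ (τ₁ U') * b (τ₂ (τ₁ U')) ∂(σ U₀)) ∂(σ U₀)| ≤ A →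
        |(∫ U, (h (τ₁ U) - h U) * (r₁ U * r₂ (τ₁ U) * b (τ₂ (τ₁ U)) / ∫ U', r₁ U' * r₂ (τ₁ U') * b (τ₂ (τ₁ U')) ∂(σ U₀)) ∂(σ U₀))
            - (∫ U, (h (τ₁ U) - h U) * (r₁ U * b (τ₁ U) / ∫ U', r₁ U' * b (τ₁ U') ∂(σ U₀)) ∂(σ U₀))| ≤ L₁ →
        |(∫ U, (h (τ₂ U) - h U) * (r₁ U * r₂ (τ₁ U) * b (τ₂ (τ₁ U)) / ∫ U', r₁ U' * r₂ (τ₁ U') * b (τ₂ (τ₁ U')) ∂(σ U₀)) ∂(σ U₀))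
            - (∫ U, (h (τ₂ U) - h U) * (r₂ U * b (τ₂ U) / ∫ U', r₂ U' * b (τ₂ U') ∂(σ U₀)) ∂(σ U₀))| ≤ L₂ →
        |(∫ U, h U * (r₁ U * r₂ (τ₁ U) * b (τ₂ (τ₁ U)) / ∫ U', r₁ U' * r₂ (τ₁ U') * b (τ₂ (τ₁ U')) ∂(σ U₀)) ∂(σ U₀))
            - (∫ U, h U * (r₁ U * b (τ₁ U) / ∫ U', r₁ U' * b (τ₁ U') ∂(σ U₀)) ∂(σ U₀))
            - (∫ U, h U * (r₂ U * b (τ₂ U) / ∫ U', r₂ U' * b (τ₂ U') ∂(σ U₀)) ∂(σ U₀))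
            + (∫ U, h U * (b U / ∫ U', b U' ∂(σ U₀)) ∂(σ U₀))| ≤ L₀ →
        |(∫ U, h U * b U ∂(σ (g₂ (g₁ U₀)))) / (∫ U, b U ∂(σ (g₂ (g₁ U₀))))
          - (∫ U, h U * b U ∂(σ (g₁ U₀))) / (∫ U, b U ∂(σ (g₁ U₀)))
          - (∫ U, h U * b U ∂(σ (g₂ U₀))) / (∫ U, b U ∂(σ (g₂ U₀)))
          + (∫ U, h U * b U ∂(σ U₀)) / (∫ U, b U ∂(σ U₀))| ≤ A + L₁ + L₂ + L₀ := by
  filter_upwards [ae_corner_package_transport m hd σ hbind hfib g₁ g₂ hτ₁ hτ₂ hcov₁ hcov₂ hr₁ hr₂ hr₁pos hr₂pos hcv₁ hcv₂ hh hb hbM hb0]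
    with U₀ hP
  intro hD₀₀ hD₁₀ hD₀₁ hD₁₁ A L₁ L₂ L₀ hA hL₁ hL₂ hL₀
  obtain ⟨e₀₀, e₁₀, e₀₁, e₁₁, n₀₀, n₁₀, n₀₁, n₁₁, iw₀₀, iw₁₀, iw₀₁, iw₁₁, -, -, -, -⟩ := hP hD₀₀ hD₁₀ hD₀₁ hD₁₁
  rw [e₁₁, e₁₀, e₀₁, e₀₀]
  exact abs_fibreMean_secondDiff_le_response (σ U₀) h (fun U => h (τ₁ U)) (fun U => h (τ₂ U)) (fun U => h (τ₂ (τ₁ U)))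
    (fun U => b U / ∫ U', b U' ∂(σ U₀)) (fun U => r₁ U * b (τ₁ U) / ∫ U', r₁ U' * b (τ₁ U') ∂(σ U₀))
    (fun U => r₂ U * b (τ₂ U) / ∫ U', r₂ U' * b (τ₂ U') ∂(σ U₀))
    (fun U => r₁ U * r₂ (τ₁ U) * b (τ₂ (τ₁ U)) / ∫ U', r₁ U' * r₂ (τ₁ U') * b (τ₂ (τ₁ U')) ∂(σ U₀))
    M A L₁ L₂ L₀ hh.aestronglyMeasurable (hh.comp hτ₁).aestronglyMeasurable (hh.comp hτ₂).aestronglyMeasurable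
    (hh.comp (hτ₂.comp hτ₁)).aestronglyMeasurable hhM (fun U => hhM _) (fun U => hhM _) (fun U => hhM _)
    iw₀₀ iw₁₀ iw₀₁ iw₁₁ n₀₀ n₁₀ n₀₁ n₁₁ hA hL₁ hL₂ hL₀

end Summit.QuantumFields.YangMills.Theorems.OrganTangentFibreMeanSquareTransportResponse

end
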